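import Mathlib
import Summits.NavierStokesRegularity.NavierStokesRegularity.Theorems.SubOnsagerCeilingVirtualFloorFaces
import HarnessLib

/-!
# Depth-2 virtual-floor game, TOP-SHELL form: the game hypothesis FROM A FACE CERTIFICATE (linear facets + cubic floors)
(helper file for crux stmt-NavierStokesRegularity-27057 `SubOnsagerCeiling.ForwardTailCeilingKP`, `--supports … --as helper`;
LEAD SOC census v11 / line «kp-shell-barrier», virtual-floor game)

Sibling of `SubOnsagerCeilingVirtualFloorPolyCert` (`game_of_polyCert`, p671432) for the SHARPER game hypothesis consumed by
`VirtualFloor.chain_shellBarrier_of_game_top` / `gameBarrier_le_one_of_tail_top'`: along a play the real shells are KNOWN to be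
`≤ 1` (the bootstrap box of the first-crossing argument), so
* every face condition (`hLin`, `hFlo0/1/2`) and the safety condition (`hSafe`) may assume `x₀, x₁, x₂ ≤ 1` in addition to the
  region predicate, and
* `hSafe` only has to deliver `x₂ < 1` (the TOP shell); the conclusion is `S 2 t < 1` on `[0, T]`.
Everything else — the region `Ω` cut out by `m` linear facets `a j·x ≤ c j` with `a j 3 ≤ 0` and three cubic floors
`κ i·xᵢ³ − ε i ≤ xᵢ₊₁`, the INERTIAL (`< 0` for all feeds `V ∈ [0,1]`) and DAMPING-SIGN (`≥ 0`) inequalities per active face,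
the initial box `[0,1/10]³ × [0,1]`, and the first-exit proof via `forall_le_of_hasDerivWithinAt_Ici_of_active_lt_of_le`
(p670150) — is verbatim the sibling's (adapted from `SubOnsagerCeilingVirtualFloorPolyCert.lean`).

Why: LEAD g8 numerics (census v11) — with the bootstrap box the depth-2 game value at `b = 3/2` is `0.875` (top shell) instead of
`0.931` (all shells, binding at the bottom shell), i.e. the certificate no longer has to cap the lower shells tightly.
No numerical certificate is proved here. HONEST FRAMING: an abstract ODE lemma towards a MODEL-lattice rung (crux
`ForwardTailCeilingKP`, route SubOnsagerCeiling, TL-M2Break); nothing here bears on Navier–Stokes regularity; 27057 stays OPEN.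
[cite: BarbatoMorandinRomito2011, §2 Lemma 2.1 (invariant-region scheme this generalises)] [cite: Hartman2002, Ch. III §4 Cor 4.1]
-/

noncomputable section

-- the sub-problem namespace `NavierStokesRegularity.NavierStokesRegularity` is the tree's layout (D-0017)
set_option linter.dupNamespace false

namespace Summit.NavierStokesRegularity.NavierStokesRegularity.Theorems.VirtualFloor

open Set Filter Topology

set_option maxHeartbeats 400000 in
/-- **The depth-2 TOP-SHELL game hypothesis from a face certificate.** Data: `m` linear facets `(a j, c j)` with `a j 3 ≤ 0`,
three cubic floors `(κ i, ε i)`. Writing `InΩ x₀ x₁ x₂ x₃` for «`0 ≤ xᵢ`, `x₀, x₁, x₂, x₃ ≤ 1`, all facets, all floors» (the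
bootstrap box included), assume: `hInit` (the datum box is inside), `hSafe` (inside ⇒ TOP shell `x₂ < 1`), and for every ACTIVE
face the strict inertial inequality for all feeds `V ∈ [0,1]` together with the damping sign condition (`hLin`, `hFlo0`,
`hFlo1`, `hFlo2`). Then every play of the depth-2 rigid-damping virtual-floor game with constants `(L, p, b2)` and datum
`1/10` whose real shells stay `≤ 1` keeps its TOP shell `< 1` — verbatim the hypothesis `hGame` of
`gameBarrier_le_one_of_tail_top'` / `chain_shellBarrier_of_game_top` at `k = 2`.
[cite: BarbatoMorandinRomito2011, §2 Lemma 2.1 (first-exit scheme)] -/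
theorem game_top_of_polyCert {L p b2 : ℝ} {m : ℕ} {a : Fin m → Fin 4 → ℝ} {c : Fin m → ℝ} {κ ε : Fin 3 → ℝ}
    (ha3 : ∀ j, a j 3 ≤ 0)
    (hInit : ∀ x₀ x₁ x₂ x₃ : ℝ, 0 ≤ x₀ → x₀ ≤ 1 / 10 → 0 ≤ x₁ → x₁ ≤ 1 / 10 → 0 ≤ x₂ → x₂ ≤ 1 / 10 →
      0 ≤ x₃ → x₃ ≤ 1 →
      (∀ j, a j 0 * x₀ + a j 1 * x₁ + a j 2 * x₂ + a j 3 * x₃ ≤ c j) ∧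
        κ 0 * x₀ ^ 3 - ε 0 ≤ x₁ ∧ κ 1 * x₁ ^ 3 - ε 1 ≤ x₂ ∧ κ 2 * x₂ ^ 3 - ε 2 ≤ x₃)
    (hSafe : ∀ x₀ x₁ x₂ x₃ : ℝ, 0 ≤ x₀ → 0 ≤ x₁ → 0 ≤ x₂ → x₀ ≤ 1 → x₁ ≤ 1 → x₂ ≤ 1 → 0 ≤ x₃ → x₃ ≤ 1 →
      (∀ j, a j 0 * x₀ + a j 1 * x₁ + a j 2 * x₂ + a j 3 * x₃ ≤ c j) →
      κ 0 * x₀ ^ 3 - ε 0 ≤ x₁ → κ 1 * x₁ ^ 3 - ε 1 ≤ x₂ → κ 2 * x₂ ^ 3 - ε 2 ≤ x₃ →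
      x₂ < 1)
    (hLin : ∀ j, ∀ x₀ x₁ x₂ x₃ : ℝ, 0 ≤ x₀ → 0 ≤ x₁ → 0 ≤ x₂ → x₀ ≤ 1 → x₁ ≤ 1 → x₂ ≤ 1 → 0 ≤ x₃ → x₃ ≤ 1 →
      (∀ j', a j' 0 * x₀ + a j' 1 * x₁ + a j' 2 * x₂ + a j' 3 * x₃ ≤ c j') →
      κ 0 * x₀ ^ 3 - ε 0 ≤ x₁ → κ 1 * x₁ ^ 3 - ε 1 ≤ x₂ → κ 2 * x₂ ^ 3 - ε 2 ≤ x₃ →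
      a j 0 * x₀ + a j 1 * x₁ + a j 2 * x₂ + a j 3 * x₃ = c j →
      (∀ V : ℝ, 0 ≤ V → V ≤ 1 →
        a j 0 * (V - p * x₀ * x₁) + a j 1 * (L * (x₀ ^ 2 - p * x₁ * x₂)) +
          a j 2 * (L ^ 2 * (x₁ ^ 2 - p * x₂ * x₃)) + a j 3 * (L ^ 3 * (x₂ ^ 2 - p * x₃)) < 0) ∧
      0 ≤ a j 0 * x₀ + a j 1 * (b2 * x₁) + a j 2 * (b2 ^ 2 * x₂) + a j 3 * (b2 ^ 3 * x₃))
    (hFlo0 : ∀ x₀ x₁ x₂ x₃ : ℝ, 0 ≤ x₀ → 0 ≤ x₁ → 0 ≤ x₂ → x₀ ≤ 1 → x₁ ≤ 1 → x₂ ≤ 1 → 0 ≤ x₃ → x₃ ≤ 1 →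
      (∀ j', a j' 0 * x₀ + a j' 1 * x₁ + a j' 2 * x₂ + a j' 3 * x₃ ≤ c j') →
      κ 0 * x₀ ^ 3 - ε 0 ≤ x₁ → κ 1 * x₁ ^ 3 - ε 1 ≤ x₂ → κ 2 * x₂ ^ 3 - ε 2 ≤ x₃ →
      κ 0 * x₀ ^ 3 - ε 0 = x₁ →
      (∀ V : ℝ, 0 ≤ V → V ≤ 1 →
        3 * κ 0 * x₀ ^ 2 * (V - p * x₀ * x₁) - L * (x₀ ^ 2 - p * x₁ * x₂) < 0) ∧
      0 ≤ 3 * κ 0 * x₀ ^ 2 * x₀ - b2 * x₁)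
    (hFlo1 : ∀ x₀ x₁ x₂ x₃ : ℝ, 0 ≤ x₀ → 0 ≤ x₁ → 0 ≤ x₂ → x₀ ≤ 1 → x₁ ≤ 1 → x₂ ≤ 1 → 0 ≤ x₃ → x₃ ≤ 1 →
      (∀ j', a j' 0 * x₀ + a j' 1 * x₁ + a j' 2 * x₂ + a j' 3 * x₃ ≤ c j') →
      κ 0 * x₀ ^ 3 - ε 0 ≤ x₁ → κ 1 * x₁ ^ 3 - ε 1 ≤ x₂ → κ 2 * x₂ ^ 3 - ε 2 ≤ x₃ →
      κ 1 * x₁ ^ 3 - ε 1 = x₂ →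
      (3 * κ 1 * x₁ ^ 2 * (L * (x₀ ^ 2 - p * x₁ * x₂)) - L ^ 2 * (x₁ ^ 2 - p * x₂ * x₃) < 0) ∧
      0 ≤ 3 * κ 1 * x₁ ^ 2 * (b2 * x₁) - b2 ^ 2 * x₂)
    (hFlo2 : ∀ x₀ x₁ x₂ x₃ : ℝ, 0 ≤ x₀ → 0 ≤ x₁ → 0 ≤ x₂ → x₀ ≤ 1 → x₁ ≤ 1 → x₂ ≤ 1 → 0 ≤ x₃ → x₃ ≤ 1 →
      (∀ j', a j' 0 * x₀ + a j' 1 * x₁ + a j' 2 * x₂ + a j' 3 * x₃ ≤ c j') →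
      κ 0 * x₀ ^ 3 - ε 0 ≤ x₁ → κ 1 * x₁ ^ 3 - ε 1 ≤ x₂ → κ 2 * x₂ ^ 3 - ε 2 ≤ x₃ →
      κ 2 * x₂ ^ 3 - ε 2 = x₃ →
      (3 * κ 2 * x₂ ^ 2 * (L ^ 2 * (x₁ ^ 2 - p * x₂ * x₃)) - L ^ 3 * (x₂ ^ 2 - p * x₃) < 0) ∧
      0 ≤ 3 * κ 2 * x₂ ^ 2 * (b2 ^ 2 * x₂) - b2 ^ 3 * x₃) :
    ∀ (Fr T : ℝ), 0 < Fr → 0 < T →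
      ∀ (S : ℕ → ℝ → ℝ) (d : ℝ) (v y : ℝ → ℝ),
      (∀ i, i ≤ 2 → ContinuousOn (S i) (Icc 0 T)) → ContinuousOn y (Icc 0 T) →
      (∀ i, i ≤ 2 → ∀ t ∈ Ico 0 T, HasDerivWithinAt (S i)
        (-(d * b2 ^ i) * S i t + Fr * L ^ i * ((if i = 0 then v t else S (i - 1) t) ^ 2 -
          p * S i t * (if i = 2 then y t else S (i + 1) t))) (Ici t) t) →
      (∀ t ∈ Ico 0 T, ∃ y' : ℝ, HasDerivWithinAt y y' (Ici t) t ∧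
        -(d * b2 ^ (2 + 1)) * y t + Fr * L ^ (2 + 1) * (S 2 t ^ 2 - p * y t) ≤ y') →
      0 ≤ d →
      (∀ t ∈ Icc 0 T, 0 ≤ v t ∧ v t ≤ 1) → (∀ t ∈ Icc 0 T, 0 ≤ y t ∧ y t ≤ 1) →
      (∀ i, i ≤ 2 → ∀ t ∈ Icc 0 T, 0 ≤ S i t) → (∀ i, i ≤ 2 → S i 0 ≤ 1 / 10) →
      (∀ i, i ≤ 2 → ∀ t ∈ Icc 0 T, S i t ≤ 1) →
      ∀ t ∈ Icc 0 T, S 2 t < 1 := by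
  intro Fr T hFr hT S d v y hSc hyc hSd hyd hd hv hy hS0 hSinit hS1
  -- the exact derivatives of the three real shells
  have hd0 : ∀ t ∈ Ico 0 T, HasDerivWithinAt (S 0)
      (-(d * b2 ^ 0) * S 0 t + Fr * L ^ 0 * (v t ^ 2 - p * S 0 t * S 1 t)) (Ici t) t := by
    intro t ht; simpa using hSd 0 (by norm_num) t ht
  have hd1 : ∀ t ∈ Ico 0 T, HasDerivWithinAt (S 1)
      (-(d * b2 ^ 1) * S 1 t + Fr * L ^ 1 * (S 0 t ^ 2 - p * S 1 t * S 2 t)) (Ici t) t := by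
    intro t ht; simpa using hSd 1 (by norm_num) t ht
  have hd2 : ∀ t ∈ Ico 0 T, HasDerivWithinAt (S 2)
      (-(d * b2 ^ 2) * S 2 t + Fr * L ^ 2 * (S 1 t ^ 2 - p * S 2 t * y t)) (Ici t) t := by
    intro t ht; simpa using hSd 2 (by norm_num) t ht
  -- abbreviations for the derivative values
  set D0 : ℝ → ℝ := fun t => -(d * b2 ^ 0) * S 0 t + Fr * L ^ 0 * (v t ^ 2 - p * S 0 t * S 1 t) with hD0
  set D1 : ℝ → ℝ := fun t => -(d * b2 ^ 1) * S 1 t + Fr * L ^ 1 * (S 0 t ^ 2 - p * S 1 t * S 2 t) with hD1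
  set D2 : ℝ → ℝ := fun t => -(d * b2 ^ 2) * S 2 t + Fr * L ^ 2 * (S 1 t ^ 2 - p * S 2 t * y t) with hD2
  -- the lower bound for `ẏ`
  set Dy : ℝ → ℝ := fun t => -(d * b2 ^ (2 + 1)) * y t + Fr * L ^ (2 + 1) * (S 2 t ^ 2 - p * y t) with hDy
  -- the faces: `m` linear facets and three cubic floors
  set h : Fin m ⊕ Fin 3 → ℝ → ℝ := fun k t =>
    match k with
    | Sum.inl j => a j 0 * S 0 t + a j 1 * S 1 t + a j 2 * S 2 t + a j 3 * y t
    | Sum.inr i =>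
      if i = 0 then κ 0 * S 0 t ^ 3 - ε 0 - S 1 t
      else if i = 1 then κ 1 * S 1 t ^ 3 - ε 1 - S 2 t else κ 2 * S 2 t ^ 3 - ε 2 - y t with hh
  set lv : Fin m ⊕ Fin 3 → ℝ := fun k => match k with
    | Sum.inl j => c j
    | Sum.inr _ => 0 with hlv
  -- the upper bounds for the right derivatives of the faces
  set h' : Fin m ⊕ Fin 3 → ℝ → ℝ := fun k t =>
    match k with
    | Sum.inl j => a j 0 * D0 t + a j 1 * D1 t + a j 2 * D2 t + a j 3 * Dy t
    | Sum.inr i =>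
      if i = 0 then 3 * κ 0 * S 0 t ^ 2 * D0 t - D1 t
      else if i = 1 then 3 * κ 1 * S 1 t ^ 2 * D1 t - D2 t else 3 * κ 2 * S 2 t ^ 2 * D2 t - Dy t with hh'
  have hi0 : ∀ i : Fin 3, i ≠ 0 → i ≠ 1 → i = 2 := by decide
  -- continuity of the faces
  have hc0 := hSc 0 (by norm_num)
  have hc1 := hSc 1 (by norm_num)
  have hc2 := hSc 2 (by norm_num)
  have hcont : ∀ k, ContinuousOn (h k) (Icc 0 T) := by
    rintro (j | i)
    · change ContinuousOn (fun t => a j 0 * S 0 t + a j 1 * S 1 t + a j 2 * S 2 t + a j 3 * y t) (Icc 0 T)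
      exact (((continuousOn_const.mul hc0).add (continuousOn_const.mul hc1)).add
        (continuousOn_const.mul hc2)).add (continuousOn_const.mul hyc)
    · by_cases h0 : i = 0
      · subst h0
        change ContinuousOn (fun t => κ 0 * S 0 t ^ 3 - ε 0 - S 1 t) (Icc 0 T)
        exact ((continuousOn_const.mul (hc0.pow 3)).sub continuousOn_const).sub hc1
      by_cases h1 : i = 1
      · subst h1
        change ContinuousOn (fun t => κ 1 * S 1 t ^ 3 - ε 1 - S 2 t) (Icc 0 T)
        exact ((continuousOn_const.mul (hc1.pow 3)).sub continuousOn_const).sub hc2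
      obtain rfl := hi0 i h0 h1
      change ContinuousOn (fun t => if (2 : Fin 3) = 0 then κ 0 * S 0 t ^ 3 - ε 0 - S 1 t
        else if (2 : Fin 3) = 1 then κ 1 * S 1 t ^ 3 - ε 1 - S 2 t else κ 2 * S 2 t ^ 3 - ε 2 - y t) (Icc 0 T)
      simp only [show ((2 : Fin 3) = 0) = False by decide, show ((2 : Fin 3) = 1) = False by decide,
        if_false]
      exact ((continuousOn_const.mul (hc2.pow 3)).sub continuousOn_const).sub hyc
  -- right derivatives of the faces, bounded by `h'`
  have hcube : ∀ (f : ℝ → ℝ) (f' t : ℝ), HasDerivWithinAt f f' (Ici t) t →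
      HasDerivWithinAt (fun s => f s ^ 3) (3 * f t ^ 2 * f') (Ici t) t := by
    intro f f' t hf
    have h2 := (hf.mul hf).mul hf
    simp only [Pi.mul_apply] at h2
    have hfun : (fun s => f s ^ 3) = f * f * f := by
      funext s; simp only [Pi.mul_apply]; ring
    rw [hfun]
    exact h2.congr_deriv (by ring)
  have hder : ∀ k, ∀ t ∈ Ico 0 T, ∃ D : ℝ, HasDerivWithinAt (h k) D (Ici t) t ∧ D ≤ h' k t := by
    rintro (j | i) t ht
    · obtain ⟨y', hy', hylo⟩ := hyd t ht
      refine ⟨a j 0 * D0 t + a j 1 * D1 t + a j 2 * D2 t + a j 3 * y', ?_, ?_⟩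
      · change HasDerivWithinAt (fun t => a j 0 * S 0 t + a j 1 * S 1 t + a j 2 * S 2 t + a j 3 * y t) _ (Ici t) t
        exact ((((hd0 t ht).const_mul (a j 0)).add ((hd1 t ht).const_mul (a j 1))).add
          ((hd2 t ht).const_mul (a j 2))).add (hy'.const_mul (a j 3))
      · change _ ≤ a j 0 * D0 t + a j 1 * D1 t + a j 2 * D2 t + a j 3 * Dy t
        have : a j 3 * y' ≤ a j 3 * Dy t := mul_le_mul_of_nonpos_left hylo (ha3 j)
        linarith
    · by_cases h0 : i = 0
      · subst h0
        refine ⟨3 * κ 0 * S 0 t ^ 2 * D0 t - D1 t, ?_, ?_⟩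
        · change HasDerivWithinAt (fun t => κ 0 * S 0 t ^ 3 - ε 0 - S 1 t) _ (Ici t) t
          have h3 := ((hcube (S 0) (D0 t) t (hd0 t ht)).const_mul (κ 0)).sub_const (ε 0)
          have h4 := h3.sub (hd1 t ht)
          refine h4.congr_deriv ?_
          ring
        · change _ ≤ 3 * κ 0 * S 0 t ^ 2 * D0 t - D1 t
          exact le_rfl
      by_cases h1 : i = 1
      · subst h1
        refine ⟨3 * κ 1 * S 1 t ^ 2 * D1 t - D2 t, ?_, ?_⟩
        · change HasDerivWithinAt (fun t => κ 1 * S 1 t ^ 3 - ε 1 - S 2 t) _ (Ici t) t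
          have h3 := ((hcube (S 1) (D1 t) t (hd1 t ht)).const_mul (κ 1)).sub_const (ε 1)
          have h4 := h3.sub (hd2 t ht)
          refine h4.congr_deriv ?_
          ring
        · change _ ≤ 3 * κ 1 * S 1 t ^ 2 * D1 t - D2 t
          exact le_rfl
      obtain rfl := hi0 i h0 h1
      obtain ⟨y', hy', hylo⟩ := hyd t ht
      refine ⟨3 * κ 2 * S 2 t ^ 2 * D2 t - y', ?_, ?_⟩
      · change HasDerivWithinAt (fun t => if (2 : Fin 3) = 0 then κ 0 * S 0 t ^ 3 - ε 0 - S 1 t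
          else if (2 : Fin 3) = 1 then κ 1 * S 1 t ^ 3 - ε 1 - S 2 t else κ 2 * S 2 t ^ 3 - ε 2 - y t) _ (Ici t) t
        simp only [show ((2 : Fin 3) = 0) = False by decide, show ((2 : Fin 3) = 1) = False by decide,
          if_false]
        have h3 := ((hcube (S 2) (D2 t) t (hd2 t ht)).const_mul (κ 2)).sub_const (ε 2)
        have h4 := h3.sub hy'
        refine h4.congr_deriv ?_
        ring
      · change _ ≤ (if (2 : Fin 3) = 0 then 3 * κ 0 * S 0 t ^ 2 * D0 t - D1 t
          else if (2 : Fin 3) = 1 then 3 * κ 1 * S 1 t ^ 2 * D1 t - D2 t else 3 * κ 2 * S 2 t ^ 2 * D2 t - Dy t)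
        simp only [show ((2 : Fin 3) = 0) = False by decide, show ((2 : Fin 3) = 1) = False by decide,
          if_false]
        linarith
  -- from «all faces hold at `t`» to the region predicate
  have hΩ : ∀ t ∈ Icc 0 T, (∀ k, h k t ≤ lv k) →
      (∀ j', a j' 0 * S 0 t + a j' 1 * S 1 t + a j' 2 * S 2 t + a j' 3 * y t ≤ c j') ∧
      κ 0 * S 0 t ^ 3 - ε 0 ≤ S 1 t ∧ κ 1 * S 1 t ^ 3 - ε 1 ≤ S 2 t ∧ κ 2 * S 2 t ^ 3 - ε 2 ≤ y t := by
    intro t _ hall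
    refine ⟨fun j' => hall (Sum.inl j'), ?_, ?_, ?_⟩
    · have := hall (Sum.inr 0)
      change κ 0 * S 0 t ^ 3 - ε 0 - S 1 t ≤ 0 at this
      linarith
    · have := hall (Sum.inr 1)
      change (if (1 : Fin 3) = 0 then κ 0 * S 0 t ^ 3 - ε 0 - S 1 t
        else if (1 : Fin 3) = 1 then κ 1 * S 1 t ^ 3 - ε 1 - S 2 t else κ 2 * S 2 t ^ 3 - ε 2 - y t) ≤ 0 at this
      simp only [show ((1 : Fin 3) = 0) = False by decide, if_false, if_true] at this
      linarith
    · have := hall (Sum.inr 2)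
      change (if (2 : Fin 3) = 0 then κ 0 * S 0 t ^ 3 - ε 0 - S 1 t
        else if (2 : Fin 3) = 1 then κ 1 * S 1 t ^ 3 - ε 1 - S 2 t else κ 2 * S 2 t ^ 3 - ε 2 - y t) ≤ 0 at this
      simp only [show ((2 : Fin 3) = 0) = False by decide, show ((2 : Fin 3) = 1) = False by decide,
        if_false] at this
      linarith
  -- the strict active-face condition
  have hface : ∀ t ∈ Ico 0 T, (∀ k, h k t ≤ lv k) → ∀ k, h k t = lv k → h' k t < 0 := by
    intro t ht hall k hk
    have htI : t ∈ Icc 0 T := Ico_subset_Icc_self ht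
    obtain ⟨hfac, hf0, hf1, hf2⟩ := hΩ t htI hall
    have hx0 := hS0 0 (by norm_num) t htI
    have hx1 := hS0 1 (by norm_num) t htI
    have hx2 := hS0 2 (by norm_num) t htI
    have hu0 := hS1 0 (by norm_num) t htI
    have hu1 := hS1 1 (by norm_num) t htI
    have hu2 := hS1 2 (by norm_num) t htI
    obtain ⟨hy0, hy1⟩ := hy t htI
    obtain ⟨hv0, hv1⟩ := hv t htI
    have hV0 : 0 ≤ v t ^ 2 := sq_nonneg _
    have hV1 : v t ^ 2 ≤ 1 := by nlinarith
    rcases k with j | i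
    · have hkj : a j 0 * S 0 t + a j 1 * S 1 t + a j 2 * S 2 t + a j 3 * y t = c j := hk
      obtain ⟨hQ, hSt⟩ := hLin j (S 0 t) (S 1 t) (S 2 t) (y t) hx0 hx1 hx2 hu0 hu1 hu2 hy0 hy1 hfac hf0 hf1 hf2 hkj
      have hQV := hQ (v t ^ 2) hV0 hV1
      change a j 0 * D0 t + a j 1 * D1 t + a j 2 * D2 t + a j 3 * Dy t < 0
      have key : a j 0 * D0 t + a j 1 * D1 t + a j 2 * D2 t + a j 3 * Dy t =
          Fr * (a j 0 * (v t ^ 2 - p * S 0 t * S 1 t) + a j 1 * (L * (S 0 t ^ 2 - p * S 1 t * S 2 t)) +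
            a j 2 * (L ^ 2 * (S 1 t ^ 2 - p * S 2 t * y t)) + a j 3 * (L ^ 3 * (S 2 t ^ 2 - p * y t))) -
          d * (a j 0 * S 0 t + a j 1 * (b2 * S 1 t) + a j 2 * (b2 ^ 2 * S 2 t) + a j 3 * (b2 ^ 3 * y t)) := by
        simp only [hD0, hD1, hD2, hDy]; ring
      have hneg : Fr * (a j 0 * (v t ^ 2 - p * S 0 t * S 1 t) + a j 1 * (L * (S 0 t ^ 2 - p * S 1 t * S 2 t)) +
          a j 2 * (L ^ 2 * (S 1 t ^ 2 - p * S 2 t * y t)) + a j 3 * (L ^ 3 * (S 2 t ^ 2 - p * y t))) < 0 :=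
        mul_neg_of_pos_of_neg hFr hQV
      have hdmp : 0 ≤ d * (a j 0 * S 0 t + a j 1 * (b2 * S 1 t) + a j 2 * (b2 ^ 2 * S 2 t) +
          a j 3 * (b2 ^ 3 * y t)) := mul_nonneg hd hSt
      rw [key]; linarith
    · by_cases h0 : i = 0
      · subst h0
        have hk0 : κ 0 * S 0 t ^ 3 - ε 0 - S 1 t = 0 := hk
        obtain ⟨hQ, hSt⟩ := hFlo0 (S 0 t) (S 1 t) (S 2 t) (y t) hx0 hx1 hx2 hu0 hu1 hu2 hy0 hy1 hfac hf0 hf1 hf2 (by linarith)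
        have hQV := hQ (v t ^ 2) hV0 hV1
        change 3 * κ 0 * S 0 t ^ 2 * D0 t - D1 t < 0
        have key : 3 * κ 0 * S 0 t ^ 2 * D0 t - D1 t =
            Fr * (3 * κ 0 * S 0 t ^ 2 * (v t ^ 2 - p * S 0 t * S 1 t) - L * (S 0 t ^ 2 - p * S 1 t * S 2 t)) -
            d * (3 * κ 0 * S 0 t ^ 2 * S 0 t - b2 * S 1 t) := by
          simp only [hD0, hD1]; ring
        have hneg : Fr * (3 * κ 0 * S 0 t ^ 2 * (v t ^ 2 - p * S 0 t * S 1 t) -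
            L * (S 0 t ^ 2 - p * S 1 t * S 2 t)) < 0 := mul_neg_of_pos_of_neg hFr hQV
        have hdmp : 0 ≤ d * (3 * κ 0 * S 0 t ^ 2 * S 0 t - b2 * S 1 t) := mul_nonneg hd hSt
        rw [key]; linarith
      by_cases h1 : i = 1
      · subst h1
        have hk1 : (if (1 : Fin 3) = 0 then κ 0 * S 0 t ^ 3 - ε 0 - S 1 t
          else if (1 : Fin 3) = 1 then κ 1 * S 1 t ^ 3 - ε 1 - S 2 t else κ 2 * S 2 t ^ 3 - ε 2 - y t) = 0 := hk
        simp only [show ((1 : Fin 3) = 0) = False by decide, if_false, if_true] at hk1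
        obtain ⟨hQ, hSt⟩ := hFlo1 (S 0 t) (S 1 t) (S 2 t) (y t) hx0 hx1 hx2 hu0 hu1 hu2 hy0 hy1 hfac hf0 hf1 hf2 (by linarith)
        change (if (1 : Fin 3) = 0 then 3 * κ 0 * S 0 t ^ 2 * D0 t - D1 t
          else if (1 : Fin 3) = 1 then 3 * κ 1 * S 1 t ^ 2 * D1 t - D2 t else 3 * κ 2 * S 2 t ^ 2 * D2 t - Dy t) < 0
        simp only [show ((1 : Fin 3) = 0) = False by decide, if_false, if_true]
        have key : 3 * κ 1 * S 1 t ^ 2 * D1 t - D2 t =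
            Fr * (3 * κ 1 * S 1 t ^ 2 * (L * (S 0 t ^ 2 - p * S 1 t * S 2 t)) - L ^ 2 * (S 1 t ^ 2 - p * S 2 t * y t)) -
            d * (3 * κ 1 * S 1 t ^ 2 * (b2 * S 1 t) - b2 ^ 2 * S 2 t) := by
          simp only [hD1, hD2]; ring
        have hneg : Fr * (3 * κ 1 * S 1 t ^ 2 * (L * (S 0 t ^ 2 - p * S 1 t * S 2 t)) -
            L ^ 2 * (S 1 t ^ 2 - p * S 2 t * y t)) < 0 := mul_neg_of_pos_of_neg hFr hQ
        have hdmp : 0 ≤ d * (3 * κ 1 * S 1 t ^ 2 * (b2 * S 1 t) - b2 ^ 2 * S 2 t) := mul_nonneg hd hSt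
        rw [key]; linarith
      obtain rfl := hi0 i h0 h1
      have hk2 : (if (2 : Fin 3) = 0 then κ 0 * S 0 t ^ 3 - ε 0 - S 1 t
        else if (2 : Fin 3) = 1 then κ 1 * S 1 t ^ 3 - ε 1 - S 2 t else κ 2 * S 2 t ^ 3 - ε 2 - y t) = 0 := hk
      simp only [show ((2 : Fin 3) = 0) = False by decide, show ((2 : Fin 3) = 1) = False by decide,
        if_false] at hk2
      obtain ⟨hQ, hSt⟩ := hFlo2 (S 0 t) (S 1 t) (S 2 t) (y t) hx0 hx1 hx2 hu0 hu1 hu2 hy0 hy1 hfac hf0 hf1 hf2 (by linarith)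
      change (if (2 : Fin 3) = 0 then 3 * κ 0 * S 0 t ^ 2 * D0 t - D1 t
        else if (2 : Fin 3) = 1 then 3 * κ 1 * S 1 t ^ 2 * D1 t - D2 t else 3 * κ 2 * S 2 t ^ 2 * D2 t - Dy t) < 0
      simp only [show ((2 : Fin 3) = 0) = False by decide, show ((2 : Fin 3) = 1) = False by decide,
        if_false]
      have key : 3 * κ 2 * S 2 t ^ 2 * D2 t - Dy t =
          Fr * (3 * κ 2 * S 2 t ^ 2 * (L ^ 2 * (S 1 t ^ 2 - p * S 2 t * y t)) - L ^ 3 * (S 2 t ^ 2 - p * y t)) -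
          d * (3 * κ 2 * S 2 t ^ 2 * (b2 ^ 2 * S 2 t) - b2 ^ 3 * y t) := by
        simp only [hD2, hDy]; ring
      have hneg : Fr * (3 * κ 2 * S 2 t ^ 2 * (L ^ 2 * (S 1 t ^ 2 - p * S 2 t * y t)) -
          L ^ 3 * (S 2 t ^ 2 - p * y t)) < 0 := mul_neg_of_pos_of_neg hFr hQ
      have hdmp : 0 ≤ d * (3 * κ 2 * S 2 t ^ 2 * (b2 ^ 2 * S 2 t) - b2 ^ 3 * y t) := mul_nonneg hd hSt
      rw [key]; linarith
  -- the faces hold initially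
  have h0 : ∀ k, h k 0 ≤ lv k := by
    have hT0 : (0 : ℝ) ∈ Icc 0 T := ⟨le_rfl, hT.le⟩
    obtain ⟨hy0, hy1⟩ := hy 0 hT0
    obtain ⟨hfac, hf0, hf1, hf2⟩ := hInit (S 0 0) (S 1 0) (S 2 0) (y 0)
      (hS0 0 (by norm_num) 0 hT0) (hSinit 0 (by norm_num)) (hS0 1 (by norm_num) 0 hT0) (hSinit 1 (by norm_num))
      (hS0 2 (by norm_num) 0 hT0) (hSinit 2 (by norm_num)) hy0 hy1
    rintro (j | i)
    · exact hfac j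
    · by_cases hi : i = 0
      · subst hi
        change κ 0 * S 0 0 ^ 3 - ε 0 - S 1 0 ≤ 0
        linarith
      by_cases hi1 : i = 1
      · subst hi1
        change (if (1 : Fin 3) = 0 then κ 0 * S 0 0 ^ 3 - ε 0 - S 1 0
          else if (1 : Fin 3) = 1 then κ 1 * S 1 0 ^ 3 - ε 1 - S 2 0 else κ 2 * S 2 0 ^ 3 - ε 2 - y 0) ≤ 0
        simp only [show ((1 : Fin 3) = 0) = False by decide, if_false, if_true]
        linarith
      obtain rfl := hi0 i hi hi1
      change (if (2 : Fin 3) = 0 then κ 0 * S 0 0 ^ 3 - ε 0 - S 1 0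
        else if (2 : Fin 3) = 1 then κ 1 * S 1 0 ^ 3 - ε 1 - S 2 0 else κ 2 * S 2 0 ^ 3 - ε 2 - y 0) ≤ 0
      simp only [show ((2 : Fin 3) = 0) = False by decide, show ((2 : Fin 3) = 1) = False by decide,
        if_false]
      linarith
  -- the first-exit lemma
  have hall := forall_le_of_hasDerivWithinAt_Ici_of_active_lt_of_le hcont hder hface h0
  -- conclusion
  intro t ht
  obtain ⟨hfac, hf0, hf1, hf2⟩ := hΩ t ht (hall t ht)
  obtain ⟨hy0, hy1⟩ := hy t ht
  exact hSafe (S 0 t) (S 1 t) (S 2 t) (y t) (hS0 0 (by norm_num) t ht)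
    (hS0 1 (by norm_num) t ht) (hS0 2 (by norm_num) t ht) (hS1 0 (by norm_num) t ht)
    (hS1 1 (by norm_num) t ht) (hS1 2 (by norm_num) t ht) hy0 hy1 hfac hf0 hf1 hf2

end Summit.NavierStokesRegularity.NavierStokesRegularity.Theorems.VirtualFloor

end
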